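import Literature.AlgebraicGeometry.Frobenioids.FSMIMorphisms
import HarnessLib

/-!
# A three-object base category with a non-invertible sub-automorphism (test object for
# [FrdI] Prop. 1.6 (vi), clause «Aut^sub-ample»)

Mochizuki, *The geometry of Frobenioids I: the general theory*, Kyushu J. Math. **62** (2008)
293–400, §0 p. 14 (sub-automorphisms `Aut^sub_C(A)`), §1, Definition 1.2 (iv) p. 23 ("An …
Aut^sub-ample … object of `C` is defined to be an object `C` such that … the natural map
`Aut^sub_C(C) → Aut^sub_D(C_D)` … is surjective") and Proposition 1.6 (vi) p. 28
[cite: MochizukiFrdI2008, Prop. 1.6(vi) p.28]: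

> "(vi) A object of `C′` is Aut-ample (respectively, Aut^sub-ample; End-ample) if it projects to
> such an object of `C`." — proof (p. 28): "Now assertion (vi) follows immediately from the
> definitions".

OURS (abc-iut cell, seat abc-iut-found gen 2; not a construction of the paper): the base category
`D` of a kernel witness AGAINST the clause «Aut^sub-ample» of (vi) (the clauses «Aut-ample» and
«End-ample» are `PreFrobenioid.isAutAmple_fiberProduct_of_fst` / `isEndAmple_fiberProduct_of_fst` of
`FiberProductsMorphisms.lean`; the typer of Prop. 1.6, abc-iut-found gen 0, left «Aut^sub-ample»
open: "the evident lifting argument needs … a sub-automorphism of the `C`-component with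
PRESCRIBED projection to `D`", `FiberProductsMorphisms.lean` module docstring).
`D` has three objects `P`, `Q`, `E` and arrows
`Hom(P,P) = {b k : k ∈ ℤ} ≅ ℤ`, `Hom(Q,Q) = {f j : j ∈ ℕ} ≅ ℕ`, `Hom(E,E) = {c k : k ∈ ℤ} ≅ ℤ`,
`Hom(P,Q) = {φ i : i ∈ ℤ}`, `Hom(E,Q) = {h i : i ∈ ℤ}`, all other Hom-sets empty, with
`b k ≫ b l = b (k+l)`, `b k ≫ φ i = φ (i+2k)`, `φ i ≫ f j = φ (i−2j)`, `f j ≫ f l = f (j+l)`,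
`c k ≫ c l = c (k+l)`, `c k ≫ h i = h (i+2k)`, `h i ≫ f j = h (i−2j)`.  So `f 1` is a
NON-INVERTIBLE sub-automorphism of `Q` (`b (−1) ≫ φ 0 = φ 0 ≫ f 1`, also `c (−1) ≫ h 0 = h 0 ≫ f 1`).
`D` is connected and totally epimorphic; its FSM-morphisms are the isomorphisms and the `f j`
(`φ i`, `h i` are not fiberwise-surjective: `P` and `E` have no common source).  The functor
`κ : D → D` collapsing `E` onto `P` (`c k ↦ b k`, `h i ↦ φ i`) maps FSM-morphisms to FSM-morphisms;
it is the `D′ → D` of the witness (with `D′ := D`).  The divisor monoid, the Frobenioid over `D`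
(a model Frobenioid, [FrdI] Thm. 5.2) and the witness itself are in the sequel files
`SubAmpleTestFrobenioid.lean`, `AutSubAmpleFiberProductCounterexample.lean`.
Nothing here bears on [IUTchIII] Cor. 3.12.
-/

namespace Literature.AlgebraicGeometry.Frobenioids

open CategoryTheory

namespace SubAmpleTest

/-! ### The category `D` -/

/-- The objects `P`, `Q`, `E` of the test base category `D` (OURS).
[cite: MochizukiFrdI2008, Prop. 1.6(vi) p.28] -/
inductive Dob : Type
  | P
  | Q
  | E
  deriving DecidableEq

/-- The arrows of `D`: `b k : P → P`, `f j : Q → Q` (`j ∈ ℕ`), `c k : E → E`, `φ i : P → Q`,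
`h i : E → Q` (`k, i ∈ ℤ`); no other arrows (OURS). [cite: MochizukiFrdI2008, Prop. 1.6(vi) p.28] -/
inductive Dhom : Dob → Dob → Type
  | b (k : ℤ) : Dhom .P .P
  | f (j : ℕ) : Dhom .Q .Q
  | c (k : ℤ) : Dhom .E .E
  | φ (i : ℤ) : Dhom .P .Q
  | h (i : ℤ) : Dhom .E .Q

namespace Dhom

/-- Identities: `b 0`, `f 0`, `c 0`. [cite: MochizukiFrdI2008, Prop. 1.6(vi) p.28] -/
def id : ∀ X : Dob, Dhom X X
  | .P => b 0
  | .Q => f 0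
  | .E => c 0

/-- Composition (diagrammatic order): `b k ≫ b l = b (k+l)`, `b k ≫ φ i = φ (i+2k)`,
`φ i ≫ f j = φ (i−2j)`, `f j ≫ f l = f (j+l)`, `c k ≫ c l = c (k+l)`, `c k ≫ h i = h (i+2k)`,
`h i ≫ f j = h (i−2j)`. [cite: MochizukiFrdI2008, Prop. 1.6(vi) p.28] -/
def comp : ∀ {X Y Z : Dob}, Dhom X Y → Dhom Y Z → Dhom X Z
  | _, _, _, b k, b l => b (k + l)
  | _, _, _, b k, φ i => φ (i + 2 * k)
  | _, _, _, φ i, f j => φ (i - 2 * j)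
  | _, _, _, f j, f l => f (j + l)
  | _, _, _, c k, c l => c (k + l)
  | _, _, _, c k, h i => h (i + 2 * k)
  | _, _, _, h i, f j => h (i - 2 * j)

end Dhom

/-- `D` is a category (OURS). [cite: MochizukiFrdI2008, Prop. 1.6(vi) p.28] -/
instance instCategory : Category Dob where
  Hom := Dhom
  id := Dhom.id
  comp := Dhom.comp
  id_comp := by
    rintro _ _ ⟨⟩ <;> simp [Dhom.id, Dhom.comp]
  comp_id := by
    rintro _ _ ⟨⟩ <;> simp [Dhom.id, Dhom.comp]
  assoc := by
    rintro _ _ _ _ ⟨⟩ ⟨⟩ ⟨⟩ <;> simp [Dhom.comp] <;> omega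

/-! ### Composition table as `simp` lemmas -/

/-- `𝟙 P = b 0`. [cite: MochizukiFrdI2008, Prop. 1.6(vi) p.28] -/
@[simp] theorem id_P : (𝟙 Dob.P : Dob.P ⟶ Dob.P) = Dhom.b 0 := rfl
/-- `𝟙 Q = f 0`. [cite: MochizukiFrdI2008, Prop. 1.6(vi) p.28] -/
@[simp] theorem id_Q : (𝟙 Dob.Q : Dob.Q ⟶ Dob.Q) = Dhom.f 0 := rfl
/-- `𝟙 E = c 0`. [cite: MochizukiFrdI2008, Prop. 1.6(vi) p.28] -/
@[simp] theorem id_E : (𝟙 Dob.E : Dob.E ⟶ Dob.E) = Dhom.c 0 := rfl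

/-- `b k ≫ b l = b (k+l)`. [cite: MochizukiFrdI2008, Prop. 1.6(vi) p.28] -/
@[simp] theorem b_comp_b (k l : ℤ) : (Dhom.b k ≫ Dhom.b l : Dob.P ⟶ Dob.P) = Dhom.b (k + l) := rfl
/-- `b k ≫ φ i = φ (i+2k)`. [cite: MochizukiFrdI2008, Prop. 1.6(vi) p.28] -/
@[simp] theorem b_comp_φ (k i : ℤ) : (Dhom.b k ≫ Dhom.φ i : Dob.P ⟶ Dob.Q) = Dhom.φ (i + 2 * k) :=
  rfl
/-- `φ i ≫ f j = φ (i−2j)`. [cite: MochizukiFrdI2008, Prop. 1.6(vi) p.28] -/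
@[simp] theorem φ_comp_f (i : ℤ) (j : ℕ) :
    (Dhom.φ i ≫ Dhom.f j : Dob.P ⟶ Dob.Q) = Dhom.φ (i - 2 * j) := rfl
/-- `f j ≫ f l = f (j+l)`. [cite: MochizukiFrdI2008, Prop. 1.6(vi) p.28] -/
@[simp] theorem f_comp_f (j l : ℕ) : (Dhom.f j ≫ Dhom.f l : Dob.Q ⟶ Dob.Q) = Dhom.f (j + l) := rfl
/-- `c k ≫ c l = c (k+l)`. [cite: MochizukiFrdI2008, Prop. 1.6(vi) p.28] -/
@[simp] theorem c_comp_c (k l : ℤ) : (Dhom.c k ≫ Dhom.c l : Dob.E ⟶ Dob.E) = Dhom.c (k + l) := rfl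
/-- `c k ≫ h i = h (i+2k)`. [cite: MochizukiFrdI2008, Prop. 1.6(vi) p.28] -/
@[simp] theorem c_comp_h (k i : ℤ) : (Dhom.c k ≫ Dhom.h i : Dob.E ⟶ Dob.Q) = Dhom.h (i + 2 * k) :=
  rfl
/-- `h i ≫ f j = h (i−2j)`. [cite: MochizukiFrdI2008, Prop. 1.6(vi) p.28] -/
@[simp] theorem h_comp_f (i : ℤ) (j : ℕ) :
    (Dhom.h i ≫ Dhom.f j : Dob.E ⟶ Dob.Q) = Dhom.h (i - 2 * j) := rfl

/-! ### Injectivity of the arrow families (at the type of arrows of `D`) -/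

/-- `b k = b l ↔ k = l`. [cite: MochizukiFrdI2008, Prop. 1.6(vi) p.28] -/
@[simp] theorem b_inj {k l : ℤ} : @Eq (Dob.P ⟶ Dob.P) (Dhom.b k) (Dhom.b l) ↔ k = l :=
  ⟨fun e => Dhom.b.inj e, fun e => e ▸ rfl⟩
/-- `f j = f l ↔ j = l`. [cite: MochizukiFrdI2008, Prop. 1.6(vi) p.28] -/
@[simp] theorem f_inj {j l : ℕ} : @Eq (Dob.Q ⟶ Dob.Q) (Dhom.f j) (Dhom.f l) ↔ j = l :=
  ⟨fun e => Dhom.f.inj e, fun e => e ▸ rfl⟩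
/-- `c k = c l ↔ k = l`. [cite: MochizukiFrdI2008, Prop. 1.6(vi) p.28] -/
@[simp] theorem c_inj {k l : ℤ} : @Eq (Dob.E ⟶ Dob.E) (Dhom.c k) (Dhom.c l) ↔ k = l :=
  ⟨fun e => Dhom.c.inj e, fun e => e ▸ rfl⟩
/-- `φ i = φ l ↔ i = l`. [cite: MochizukiFrdI2008, Prop. 1.6(vi) p.28] -/
@[simp] theorem φ_inj {i l : ℤ} : @Eq (Dob.P ⟶ Dob.Q) (Dhom.φ i) (Dhom.φ l) ↔ i = l :=
  ⟨fun e => Dhom.φ.inj e, fun e => e ▸ rfl⟩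
/-- `h i = h l ↔ i = l`. [cite: MochizukiFrdI2008, Prop. 1.6(vi) p.28] -/
@[simp] theorem h_inj {i l : ℤ} : @Eq (Dob.E ⟶ Dob.Q) (Dhom.h i) (Dhom.h l) ↔ i = l :=
  ⟨fun e => Dhom.h.inj e, fun e => e ▸ rfl⟩

/-! ### Isomorphisms -/

/-- `b k` is an isomorphism with inverse `b (−k)`. [cite: MochizukiFrdI2008, Prop. 1.6(vi) p.28] -/
def bIso (k : ℤ) : Dob.P ≅ Dob.P where
  hom := Dhom.b k
  inv := Dhom.b (-k)
  hom_inv_id := by simp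
  inv_hom_id := by simp

/-- `c k` is an isomorphism with inverse `c (−k)`. [cite: MochizukiFrdI2008, Prop. 1.6(vi) p.28] -/
def cIso (k : ℤ) : Dob.E ≅ Dob.E where
  hom := Dhom.c k
  inv := Dhom.c (-k)
  hom_inv_id := by simp
  inv_hom_id := by simp

/-- `b k` is an isomorphism. [cite: MochizukiFrdI2008, Prop. 1.6(vi) p.28] -/
theorem isIso_b (k : ℤ) : IsIso (X := Dob.P) (Y := Dob.P) (Dhom.b k) := (bIso k).isIso_hom

/-- `c k` is an isomorphism. [cite: MochizukiFrdI2008, Prop. 1.6(vi) p.28] -/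
theorem isIso_c (k : ℤ) : IsIso (X := Dob.E) (Y := Dob.E) (Dhom.c k) := (cIso k).isIso_hom

/-- `f j` is invertible only for `j = 0`. [cite: MochizukiFrdI2008, Prop. 1.6(vi) p.28] -/
theorem f_eq_zero_of_isIso (j : ℕ) (hj : IsIso (X := Dob.Q) (Y := Dob.Q) (Dhom.f j)) : j = 0 := by
  obtain ⟨g, hg, -⟩ := hj.out
  revert hg
  cases g with
  | f l => intro hg; simp at hg; omega

/-- `f 1` is a sub-automorphism of `Q` which is NOT an automorphism: `b 1 ≫ φ 0 = φ 0 ≫ f 1`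
(so `Aut_D(Q) ⊊ Aut^sub_D(Q)`; the witness is `(P, φ 0, b (−1))`: `b (−1) ≫ φ 0 = φ (−2) = φ 0 ≫ f 1`).
[cite: MochizukiFrdI2008, §0 p.14] -/
theorem f_one_mem_autSub : Dhom.f 1 ∈ autSub Dob.Q :=
  ⟨Dob.P, Dhom.φ 0, bIso (-1), by simp [bIso]⟩

/-- Every `f j` is a sub-automorphism of `Q` (`b (−j) ≫ φ 0 = φ (−2j) = φ 0 ≫ f j`), i.e.
`Aut^sub_D(Q) = End_D(Q)`. [cite: MochizukiFrdI2008, §0 p.14] -/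
theorem f_mem_autSub (j : ℕ) : Dhom.f j ∈ autSub Dob.Q :=
  ⟨Dob.P, Dhom.φ 0, bIso (-j), by simp [bIso]⟩

/-- `f 1` is not an isomorphism. [cite: MochizukiFrdI2008, Prop. 1.6(vi) p.28] -/
theorem not_isIso_f_one : ¬ IsIso (X := Dob.Q) (Y := Dob.Q) (Dhom.f 1) := fun h =>
  absurd (f_eq_zero_of_isIso 1 h) one_ne_zero

/-! ### `D` is connected and totally epimorphic -/

/-- `D` is totally epimorphic (every arrow is an epimorphism: all the composition laws are
translations of `ℤ`/`ℕ`). [cite: MochizukiFrdI2008, §0 p.15] -/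
theorem isTotallyEpimorphic : IsTotallyEpimorphic Dob := by
  refine ⟨fun u => ⟨fun g g' e => ?_⟩⟩
  cases u <;> cases g <;> cases g' <;> simp at e ⊢ <;> omega

/-- `D` is connected (`P → Q ← E`). [cite: MochizukiFrdI2008, §0 p.16] -/
theorem isGraphConnected : IsGraphConnected Dob := by
  have hQ : ∀ X : Dob, Zigzag X Dob.Q := by
    rintro ⟨⟩
    · exact Zigzag.of_hom (Dhom.φ 0)
    · exact Zigzag.refl _
    · exact Zigzag.of_hom (Dhom.h 0)
  exact ⟨⟨Dob.Q⟩, fun X Y => (hQ X).trans (hQ Y).symm⟩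

/-! ### FSM-morphisms of `D` -/

/-- `h i : E → Q` is not fiberwise-surjective (no object maps to both `E` and `P`), hence not an
FSM-morphism. [cite: MochizukiFrdI2008, §0 p.14] -/
theorem not_isFSM_h (i : ℤ) : ¬ IsFSM (B := Dob.E) (A := Dob.Q) (Dhom.h i) := by
  rintro ⟨hfs, -⟩
  obtain ⟨W, δB, δX, -⟩ := hfs (Dhom.φ 0)
  cases W
  · cases δB
  · cases δB
  · cases δX

/-- `φ i : P → Q` is not fiberwise-surjective, hence not an FSM-morphism.
[cite: MochizukiFrdI2008, §0 p.14] -/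
theorem not_isFSM_φ (i : ℤ) : ¬ IsFSM (B := Dob.P) (A := Dob.Q) (Dhom.φ i) := by
  rintro ⟨hfs, -⟩
  obtain ⟨W, δB, δX, -⟩ := hfs (Dhom.h 0)
  cases W
  · cases δX
  · cases δB
  · cases δB

/-! ### The collapsing functor `κ : D → D` (`E ↦ P`) -/

/-- `κ` on objects: `P ↦ P`, `Q ↦ Q`, `E ↦ P`. [cite: MochizukiFrdI2008, Prop. 1.6 p.27] -/
def κobj : Dob → Dob
  | .P => .P
  | .Q => .Q
  | .E => .P

/-- `κ` on arrows: `c k ↦ b k`, `h i ↦ φ i`, identity on `b k`, `f j`, `φ i`.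
[cite: MochizukiFrdI2008, Prop. 1.6 p.27] -/
def κmap : ∀ {X Y : Dob}, (X ⟶ Y) → (κobj X ⟶ κobj Y)
  | _, _, Dhom.b k => Dhom.b k
  | _, _, Dhom.f j => Dhom.f j
  | _, _, Dhom.c k => Dhom.b k
  | _, _, Dhom.φ i => Dhom.φ i
  | _, _, Dhom.h i => Dhom.φ i

/-- The functor `κ : D → D` collapsing `E` onto `P` — the `D′ → D` of the witness (with `D′ = D`).
[cite: MochizukiFrdI2008, Prop. 1.6 p.27] -/
def κ : Dob ⥤ Dob where
  obj := κobj
  map := κmap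
  map_id := by rintro ⟨⟩ <;> rfl
  map_comp := by rintro _ _ _ ⟨⟩ ⟨⟩ <;> rfl

/-- `κ P = P`. [cite: MochizukiFrdI2008, Prop. 1.6 p.27] -/
@[simp] theorem κ_obj_P : κ.obj Dob.P = Dob.P := rfl
/-- `κ Q = Q`. [cite: MochizukiFrdI2008, Prop. 1.6 p.27] -/
@[simp] theorem κ_obj_Q : κ.obj Dob.Q = Dob.Q := rfl
/-- `κ E = P`. [cite: MochizukiFrdI2008, Prop. 1.6 p.27] -/
@[simp] theorem κ_obj_E : κ.obj Dob.E = Dob.P := rfl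
/-- `κ (b k) = b k`. [cite: MochizukiFrdI2008, Prop. 1.6 p.27] -/
@[simp] theorem κ_map_b (k : ℤ) : κ.map (Dhom.b k) = Dhom.b k := rfl
/-- `κ (f j) = f j`. [cite: MochizukiFrdI2008, Prop. 1.6 p.27] -/
@[simp] theorem κ_map_f (j : ℕ) : κ.map (Dhom.f j) = Dhom.f j := rfl
/-- `κ (c k) = b k`. [cite: MochizukiFrdI2008, Prop. 1.6 p.27] -/
@[simp] theorem κ_map_c (k : ℤ) : κ.map (Dhom.c k) = Dhom.b k := rfl
/-- `κ (φ i) = φ i`. [cite: MochizukiFrdI2008, Prop. 1.6 p.27] -/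
@[simp] theorem κ_map_φ (i : ℤ) : κ.map (Dhom.φ i) = Dhom.φ i := rfl
/-- `κ (h i) = φ i`. [cite: MochizukiFrdI2008, Prop. 1.6 p.27] -/
@[simp] theorem κ_map_h (i : ℤ) : κ.map (Dhom.h i) = Dhom.φ i := rfl

/-- `κ` maps FSM-morphisms to FSM-morphisms (the hypothesis on `D′ → D` in Prop. 1.6): the
FSM-morphisms of `D` are the isomorphisms and the `f j`, on which `κ` is the identity up to
`c k ↦ b k`. [cite: MochizukiFrdI2008, Prop. 1.6 p.27] -/
theorem κ_map_isFSM {X Y : Dob} (u : X ⟶ Y) (hu : IsFSM u) : IsFSM (κ.map u) := by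
  cases u with
  | b k => exact hu
  | f j => exact hu
  | c k => exact @IsFSM.of_isIso Dob _ Dob.P Dob.P (Dhom.b k) (isIso_b k)
  | φ i => exact hu
  | h i => exact absurd hu (not_isFSM_h i)

end SubAmpleTest

end Literature.AlgebraicGeometry.Frobenioids
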